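import Summits.HubbardSuperconductivity.HubbardSuperconductivity.Theorems.NodalDiracTwistTwistCalibrationBdGHolonomyPinning
import Literature.MathematicalPhysics.QuantumLattice.SpinTwistedBdGModes

/-!
# Route `NodalDiracTwist` — support `TwistCalibrationBdG`: the Nambu symbol along a loop of twists (holonomy, part 4)

For stmt-HubbardSuperconductivity-1625, second clause: the Nambu symbol `z_k(φ)` (`twistNambuZ`) of a
block `k` along the loop `φ = p + r(cos θ, sin θ)` around a quartet point `p` (`|p_μ| = c`),
`0 < r < min(c, π - c)`, in node coordinates: `z = -2((1 - ih)A + (1 + ih)B)`,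
`A(θ) = cos(q₀ + r cos θ/L) - cos κ`, `B(θ) = cos(q₁ + r sin θ/L) - cos κ` (`twistNambuZ_loopPt`). Proved:
continuity and `2π`-periodicity in `θ`; **no zero-energy mode on the loop** (`twistNambuZ_loopPt_ne_zero`,
pinning in both coordinates); `A = 0` on the cut line `ℝ(1 + ih)` (`nodeA_eq_zero_of_mem_line`); and
**regular blocks avoid a cut ray** (`exists_ray_not_mem_of_regular`: a block not critical at `p` misses
`ℝ≥0·(1+ih)` or `ℝ≥0·(-(1+ih))`, by pinning and the constant sign of `B`).

Folklore (geometry of `d`-wave nodes in twist space: Karakuzu–Seki–Sorella 2018 Sec. II D). No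
definitions (the loop is a local notation for the item's literal term).
-/

-- the mandated namespace `Summit.<Summit>.<Problem>.Theorems` repeats `HubbardSuperconductivity`
-- (single-problem summit, D-0017), which the `dupNamespace` linter flags on every declaration
set_option linter.dupNamespace false

namespace Summit.HubbardSuperconductivity.HubbardSuperconductivity.Theorems.NodalDiracTwist

open Complex Set Literature.Probability.LatticeModels Literature.MathematicalPhysics.QuantumLattice
open scoped ComplexConjugate

variable {L : ℕ} [NeZero L]

/-! ### The Nambu symbol along the loop -/

omit [NeZero L] in
/-- **The Nambu symbol along the loop in node coordinates.** With `cos κ = -μ₀/4`,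
`q_μ = 2πk_μ/L + p_μ/L`, `A(θ) = cos(q₀ + r cos θ/L) - cos κ`, `B(θ) = cos(q₁ + r sin θ/L) - cos κ`:
`z_k(p + r(cos θ, sin θ)) = -2((1 - ih) A(θ) + (1 + ih) B(θ))`. [folklore] -/
theorem twistNambuZ_loopPt (μ₀ h : ℝ) {κ : ℝ} (hκ : Real.cos κ = -μ₀ / 4) (p : Fin 2 → ℝ) (r θ : ℝ)
    (k : TorusSite 2 L) :
    twistNambuZ L μ₀ h ((fun ν : Fin 2 => p ν + r * (if ν = 0 then Real.cos θ else Real.sin θ))) k =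
      -2 * ((1 - h * Complex.I) * ((Real.cos (latticeMomentum L k 0 + p 0 / L + r * Real.cos θ / L) -
          Real.cos κ : ℝ) : ℂ) +
        (1 + h * Complex.I) * ((Real.cos (latticeMomentum L k 1 + p 1 / L + r * Real.sin θ / L) -
          Real.cos κ : ℝ) : ℂ)) := by
  have hμ : μ₀ = -4 * Real.cos κ := by rw [hκ]; ring
  simp only [twistNambuZ, twistXi, twistPairSymbol, Fin.sum_univ_two, Fin.isValue, if_true,
    one_ne_zero, if_false, Fin.val_zero, pow_zero, one_mul, Fin.val_one, pow_one, hμ]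
  have e0 : latticeMomentum L k 0 + (p 0 + r * Real.cos θ) / L =
      latticeMomentum L k 0 + p 0 / L + r * Real.cos θ / L := by ring
  have e1 : latticeMomentum L k 1 + (p 1 + r * Real.sin θ) / L =
      latticeMomentum L k 1 + p 1 / L + r * Real.sin θ / L := by ring
  rw [e0, e1]
  push_cast
  ring

/-- `(1 - ih)A + (1 + ih)B` is a real multiple of `1 + ih` only if `A = 0` (`h ≠ 0`). [folklore] -/
theorem eq_zero_of_nambu_combination_eq {h A B τ : ℝ} (hh : h ≠ 0)
    (heq : (1 - h * Complex.I) * (A : ℂ) + (1 + h * Complex.I) * (B : ℂ) = (τ : ℂ) * (1 + h * Complex.I)) :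
    A = 0 := by
  have hre := congrArg Complex.re heq
  have him := congrArg Complex.im heq
  simp at hre him
  have : h * (B - A) = h * τ := by linarith
  have h2 := mul_left_cancel₀ hh this
  linarith

section Loop

variable {μ₀ h κ c r : ℝ} {p : Fin 2 → ℝ}

/-- **No zero-energy mode on the punctured loop disk.** Around a quartet point `p` (`|p_μ| = c`),
on the loop of radius `r < min(c, π - c)` no Bogoliubov mode has zero energy: a zero `z_k = 0` pins
both coordinates (`cos θ = 0 = sin θ`). [folklore] -/
theorem twistNambuZ_loopPt_ne_zero (hh : h ≠ 0) (hκ : Real.cos κ = -μ₀ / 4) (hc0 : 0 < c)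
    (hcπ : c < Real.pi) (hcos : Real.cos c = Real.cos (L * κ)) (hp0 : |p 0| = c) (hp1 : |p 1| = c)
    (hr0 : 0 < r) (hr : r < min c (Real.pi - c)) (k : TorusSite 2 L) (θ : ℝ) :
    twistNambuZ L μ₀ h ((fun ν : Fin 2 => p ν + r * (if ν = 0 then Real.cos θ else Real.sin θ))) k ≠ 0 := by
  intro h0
  rw [twistNambuZ_loopPt μ₀ h hκ] at h0
  set A : ℝ := Real.cos (latticeMomentum L k 0 + p 0 / L + r * Real.cos θ / L) - Real.cos κ with hAdef
  set B : ℝ := Real.cos (latticeMomentum L k 1 + p 1 / L + r * Real.sin θ / L) - Real.cos κ with hBdef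
  have h0' : (1 - h * Complex.I) * (A : ℂ) + (1 + h * Complex.I) * (B : ℂ) = ((0 : ℝ) : ℂ) * (1 + h * Complex.I) := by
    rw [Complex.ofReal_zero, zero_mul]
    have := mul_eq_zero.mp h0
    rcases this with h' | h'
    · norm_num at h'
    · exact h'
  have hA : A = 0 := eq_zero_of_nambu_combination_eq hh h0'
  have hB : B = 0 := by
    have := congrArg Complex.re h0'
    simp [hA] at this
    exact this
  have hcu : r * Real.cos θ = 0 := by
    refine eq_zero_of_cos_grid_eq (L := L) (k 0).val hc0 hcπ hcos hp0 ?_ hr ?_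
    · rw [abs_mul, abs_of_pos hr0]
      exact mul_le_of_le_one_right hr0.le (Real.abs_cos_le_one θ)
    · rw [sub_eq_zero] at hA
      rw [← hA, latticeMomentum]
      congr 1; ring
  have hsu : r * Real.sin θ = 0 := by
    refine eq_zero_of_cos_grid_eq (L := L) (k 1).val hc0 hcπ hcos hp1 ?_ hr ?_
    · rw [abs_mul, abs_of_pos hr0]
      exact mul_le_of_le_one_right hr0.le (Real.abs_sin_le_one θ)
    · rw [sub_eq_zero] at hB
      rw [← hB, latticeMomentum]
      congr 1; ring
  have hc' : Real.cos θ = 0 := by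
    rcases mul_eq_zero.mp hcu with h' | h'
    · exact absurd h' hr0.ne'
    · exact h'
  have hs' : Real.sin θ = 0 := by
    rcases mul_eq_zero.mp hsu with h' | h'
    · exact absurd h' hr0.ne'
    · exact h'
  have := Real.sin_sq_add_cos_sq θ
  rw [hc', hs'] at this
  norm_num at this

omit [NeZero L] in
/-- The Nambu symbol along the loop is a continuous function of the angle. [folklore] -/
theorem continuous_twistNambuZ_loopPt (hκ : Real.cos κ = -μ₀ / 4) (k : TorusSite 2 L) :
    Continuous fun θ => twistNambuZ L μ₀ h (
        (fun ν : Fin 2 => p ν + r * (if ν = 0 then Real.cos θ else Real.sin θ))) k := by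
  have : (fun θ => twistNambuZ L μ₀ h (
      (fun ν : Fin 2 => p ν + r * (if ν = 0 then Real.cos θ else Real.sin θ))) k) = fun θ =>
      -2 * ((1 - h * Complex.I) * ((Real.cos (latticeMomentum L k 0 + p 0 / L + r * Real.cos θ / L) -
          Real.cos κ : ℝ) : ℂ) +
        (1 + h * Complex.I) * ((Real.cos (latticeMomentum L k 1 + p 1 / L + r * Real.sin θ / L) -
          Real.cos κ : ℝ) : ℂ)) := funext fun θ => twistNambuZ_loopPt μ₀ h hκ p r θ k
  rw [this]
  fun_prop

omit [NeZero L] in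
/-- The Nambu symbol along the loop is `2π`-periodic in the angle. [folklore] -/
theorem twistNambuZ_loopPt_periodic (k : TorusSite 2 L) (θ : ℝ) :
    twistNambuZ L μ₀ h (
        (fun ν : Fin 2 => p ν + r * (if ν = 0 then Real.cos (θ + 2 * Real.pi) else Real.sin (θ + 2 * Real.pi)))
        ) k = twistNambuZ L μ₀ h ((fun ν : Fin 2 => p ν + r * (if ν = 0 then Real.cos θ else Real.sin θ))) k := by
  have :
      (fun ν : Fin 2 => p ν + r * (if ν = 0 then Real.cos (θ + 2 * Real.pi) else Real.sin (θ + 2 * Real.pi)))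
      = (fun ν : Fin 2 => p ν + r * (if ν = 0 then Real.cos θ else Real.sin θ)) := by
    funext ν
    simp only [Real.cos_add_two_pi, Real.sin_add_two_pi]
  rw [this]


/-- Pinning in the first coordinate: `A(θ) = 0` forces `cos θ = 0`. [folklore] -/
theorem cos_eq_zero_of_nodeA_eq_zero (hc0 : 0 < c) (hcπ : c < Real.pi)
    (hcos : Real.cos c = Real.cos (L * κ)) (hp0 : |p 0| = c) (hr0 : 0 < r) (hr : r < min c (Real.pi - c))
    (k : TorusSite 2 L) {θ : ℝ}
    (hA : Real.cos (latticeMomentum L k 0 + p 0 / L + r * Real.cos θ / L) - Real.cos κ = 0) :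
    Real.cos θ = 0 := by
  have hcu : r * Real.cos θ = 0 := by
    refine eq_zero_of_cos_grid_eq (L := L) (k 0).val hc0 hcπ hcos hp0 ?_ hr ?_
    · rw [abs_mul, abs_of_pos hr0]
      exact mul_le_of_le_one_right hr0.le (Real.abs_cos_le_one θ)
    · rw [sub_eq_zero] at hA
      rw [← hA, latticeMomentum]
      congr 1; ring
  rcases mul_eq_zero.mp hcu with h' | h'
  · exact absurd h' hr0.ne'
  · exact h'

/-- Pinning in the second coordinate: `B(θ) = 0` forces `sin θ = 0`. [folklore] -/
theorem sin_eq_zero_of_nodeB_eq_zero (hc0 : 0 < c) (hcπ : c < Real.pi)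
    (hcos : Real.cos c = Real.cos (L * κ)) (hp1 : |p 1| = c) (hr0 : 0 < r) (hr : r < min c (Real.pi - c))
    (k : TorusSite 2 L) {θ : ℝ}
    (hB : Real.cos (latticeMomentum L k 1 + p 1 / L + r * Real.sin θ / L) - Real.cos κ = 0) :
    Real.sin θ = 0 := by
  have hsu : r * Real.sin θ = 0 := by
    refine eq_zero_of_cos_grid_eq (L := L) (k 1).val hc0 hcπ hcos hp1 ?_ hr ?_
    · rw [abs_mul, abs_of_pos hr0]
      exact mul_le_of_le_one_right hr0.le (Real.abs_sin_le_one θ)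
    · rw [sub_eq_zero] at hB
      rw [← hB, latticeMomentum]
      congr 1; ring
  rcases mul_eq_zero.mp hsu with h' | h'
  · exact absurd h' hr0.ne'
  · exact h'

omit [NeZero L] in
/-- On the cut line: if `z(θ)` is a real multiple of `±(1 + ih)` then `A(θ) = 0`. [folklore] -/
theorem nodeA_eq_zero_of_mem_line (hh : h ≠ 0) (hκ : Real.cos κ = -μ₀ / 4) (k : TorusSite 2 L)
    {θ t σ : ℝ} (hz : twistNambuZ L μ₀ h ((fun ν : Fin 2 => p ν + r * (if ν = 0 then Real.cos θ else Real.sin θ))) k =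
      (t : ℂ) * ((σ : ℂ) * (1 + h * Complex.I) / (‖(1 : ℂ) + h * Complex.I‖ : ℂ))) :
    Real.cos (latticeMomentum L k 0 + p 0 / L + r * Real.cos θ / L) - Real.cos κ = 0 := by
  rw [twistNambuZ_loopPt μ₀ h hκ] at hz
  have hn : (‖(1 : ℂ) + h * Complex.I‖ : ℂ) ≠ 0 := by
    rw [Ne, Complex.ofReal_eq_zero, norm_eq_zero]
    intro h0; have := congrArg Complex.re h0; simp at this
  refine eq_zero_of_nambu_combination_eq (τ := -(t * σ / (2 * ‖(1 : ℂ) + h * Complex.I‖)))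
    (B := Real.cos (latticeMomentum L k 1 + p 1 / L + r * Real.sin θ / L) - Real.cos κ) hh ?_
  have h2 : (1 - ↑h * Complex.I) * ((Real.cos (latticeMomentum L k 0 + p 0 / ↑L + r * Real.cos θ / ↑L) -
      Real.cos κ : ℝ) : ℂ) + (1 + ↑h * Complex.I) * ((Real.cos (latticeMomentum L k 1 + p 1 / ↑L +
      r * Real.sin θ / ↑L) - Real.cos κ : ℝ) : ℂ) =
      (-2 : ℂ)⁻¹ * ((t : ℂ) * ((σ : ℂ) * (1 + h * Complex.I) / (‖(1 : ℂ) + h * Complex.I‖ : ℂ))) := by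
    rw [← hz]; ring
  rw [h2]
  push_cast
  field_simp

/-- **Regular blocks avoid a ray.** If the block `k` is not critical at the centre `p` (not both
`cos q₀ = cos κ` and `cos q₁ = cos κ`), its Nambu symbol along the loop avoids one of the closed rays
`ℝ≥0 · (±(1 + ih)/|1 + ih|)`. [folklore] -/
theorem exists_ray_not_mem_of_regular (hh : h ≠ 0) (hκ : Real.cos κ = -μ₀ / 4) (hc0 : 0 < c)
    (hcπ : c < Real.pi) (hcos : Real.cos c = Real.cos (L * κ)) (hp0 : |p 0| = c) (hp1 : |p 1| = c)
    (hr0 : 0 < r) (hr : r < min c (Real.pi - c)) (k : TorusSite 2 L)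
    (hreg : ¬ (Real.cos (latticeMomentum L k 0 + p 0 / L) = Real.cos κ ∧
      Real.cos (latticeMomentum L k 1 + p 1 / L) = Real.cos κ)) :
    ∃ d : ℂ, ‖d‖ = 1 ∧ ∀ θ, ¬ ∃ t : ℝ, 0 ≤ t ∧ twistNambuZ L μ₀ h (
        (fun ν : Fin 2 => p ν + r * (if ν = 0 then Real.cos θ else Real.sin θ))) k = t * d := by
  set ζ : ℂ := 1 + h * Complex.I with hζ
  have hζ0 : ζ ≠ 0 := by intro h0; have := congrArg Complex.re h0; simp [hζ] at this
  have hζn : 0 < ‖ζ‖ := norm_pos_iff.mpr hζ0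
  have hunit : ∀ σ : ℝ, (σ = 1 ∨ σ = -1) → ‖(σ : ℂ) * ζ / (‖ζ‖ : ℂ)‖ = 1 := by
    intro σ hσ
    rw [norm_div, norm_mul, Complex.norm_real, Complex.norm_real, Real.norm_eq_abs, Real.norm_eq_abs,
      abs_of_pos hζn]
    rcases hσ with rfl | rfl <;> simp [hζn.ne']
  set A : ℝ → ℝ := fun θ => Real.cos (latticeMomentum L k 0 + p 0 / L + r * Real.cos θ / L) - Real.cos κ
    with hAdef
  set B : ℝ → ℝ := fun θ => Real.cos (latticeMomentum L k 1 + p 1 / L + r * Real.sin θ / L) - Real.cos κ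
    with hBdef
  by_cases hq0 : Real.cos (latticeMomentum L k 0 + p 0 / L) = Real.cos κ
  · have hq1 : Real.cos (latticeMomentum L k 1 + p 1 / L) ≠ Real.cos κ := fun h1 => hreg ⟨hq0, h1⟩
    -- `B` never vanishes, hence has constant sign
    have hB0 : ∀ θ, B θ ≠ 0 := by
      intro θ hBθ
      have hs := sin_eq_zero_of_nodeB_eq_zero hc0 hcπ hcos hp1 hr0 hr k hBθ
      apply hq1
      have : B θ = Real.cos (latticeMomentum L k 1 + p 1 / L) - Real.cos κ := by
        simp only [hBdef, hs, mul_zero, zero_div, add_zero]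
      rw [← sub_eq_zero, ← this]; exact hBθ
    have hBc : Continuous B := by simp only [hBdef]; fun_prop
    have hBsign : ∀ θ, 0 < B 0 * B θ := by
      intro θ
      by_contra hcon
      push Not at hcon
      -- a zero of `B` between `0` and `θ`
      rcases le_total 0 θ with h0θ | h0θ
      · rcases le_or_gt 0 (B 0) with hB00 | hB00
        · have hB0pos : 0 < B 0 := lt_of_le_of_ne hB00 (hB0 0).symm
          have hBθ : B θ ≤ 0 := by nlinarith
          obtain ⟨x, -, hx⟩ := intermediate_value_Icc' h0θ hBc.continuousOn ⟨hBθ, hB0pos.le⟩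
          exact hB0 x hx
        · have hBθ : 0 ≤ B θ := by nlinarith
          obtain ⟨x, -, hx⟩ := intermediate_value_Icc h0θ hBc.continuousOn ⟨hB00.le, hBθ⟩
          exact hB0 x hx
      · rcases le_or_gt 0 (B 0) with hB00 | hB00
        · have hB0pos : 0 < B 0 := lt_of_le_of_ne hB00 (hB0 0).symm
          have hBθ : B θ ≤ 0 := by nlinarith
          obtain ⟨x, -, hx⟩ := intermediate_value_Icc h0θ hBc.continuousOn ⟨hBθ, hB0pos.le⟩
          exact hB0 x hx
        · have hBθ : 0 ≤ B θ := by nlinarith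
          obtain ⟨x, -, hx⟩ := intermediate_value_Icc' h0θ hBc.continuousOn ⟨hB00.le, hBθ⟩
          exact hB0 x hx
    -- the avoided ray: direction `sign(B 0) ζ/|ζ|`
    set σ : ℝ := if 0 < B 0 then 1 else -1 with hσ
    have hσ1 : σ = 1 ∨ σ = -1 := by simp only [hσ]; split_ifs <;> simp
    have hσB : ∀ θ, 0 < σ * B θ := by
      intro θ
      have := hBsign θ
      simp only [hσ]; split_ifs with hB00
      · rw [one_mul]; exact pos_of_mul_pos_right this hB00.le
      · have : B 0 < 0 := lt_of_le_of_ne (not_lt.mp hB00) (hB0 0)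
        nlinarith
    refine ⟨(σ : ℂ) * ζ / (‖ζ‖ : ℂ), hunit σ hσ1, fun θ => ?_⟩
    rintro ⟨t, ht, hz⟩
    have hA : A θ = 0 := nodeA_eq_zero_of_mem_line hh hκ k hz
    -- then `z = -2 ζ B`, so `σ B θ ≤ 0`
    rw [twistNambuZ_loopPt μ₀ h hκ] at hz
    have hAz : ((Real.cos (latticeMomentum L k 0 + p 0 / L + r * Real.cos θ / L) - Real.cos κ : ℝ) : ℂ) = 0 := by
      rw [show Real.cos (latticeMomentum L k 0 + p 0 / L + r * Real.cos θ / L) - Real.cos κ = A θ from rfl, hA,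
        Complex.ofReal_zero]
    rw [hAz, mul_zero, zero_add] at hz
    -- compare: `-2 ζ B = t σ ζ / |ζ|`
    have h3 : ((-2 * B θ : ℝ) : ℂ) * ζ = ((t * σ / ‖ζ‖ : ℝ) : ℂ) * ζ := by
      push_cast
      rw [show (B θ : ℂ) = ((Real.cos (latticeMomentum L k 1 + p 1 / L + r * Real.sin θ / L) - Real.cos κ : ℝ) : ℂ)
        from rfl]
      calc (-2 * ((Real.cos (latticeMomentum L k 1 + p 1 / ↑L + r * Real.sin θ / ↑L) - Real.cos κ : ℝ) : ℂ)) * ζ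
          = -2 * ((1 + ↑h * Complex.I) * ↑(Real.cos (latticeMomentum L k 1 + p 1 / ↑L + r * Real.sin θ / ↑L) -
              Real.cos κ)) := by rw [hζ]; ring
        _ = _ := by rw [hz, hζ]; field_simp
    have h4 := mul_right_cancel₀ hζ0 h3
    have h5 : -2 * B θ = t * σ / ‖ζ‖ := by exact_mod_cast h4
    have h6 : σ * B θ ≤ 0 := by
      have : σ * (t * σ / ‖ζ‖) = t / ‖ζ‖ := by
        rcases hσ1 with h1 | h1 <;> rw [h1] <;> ring
      have : σ * B θ = -(t / ‖ζ‖) / 2 := by rw [← this, ← h5]; ring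
      rw [this]
      have : 0 ≤ t / ‖ζ‖ := div_nonneg ht hζn.le
      linarith
    linarith [hσB θ]
  · -- `A` never vanishes: the whole line is avoided
    refine ⟨(1 : ℝ) * ζ / (‖ζ‖ : ℂ), hunit 1 (Or.inl rfl), fun θ => ?_⟩
    rintro ⟨t, -, hz⟩
    have hA : A θ = 0 := nodeA_eq_zero_of_mem_line hh hκ k hz
    have hcθ := cos_eq_zero_of_nodeA_eq_zero hc0 hcπ hcos hp0 hr0 hr k hA
    apply hq0
    have : A θ = Real.cos (latticeMomentum L k 0 + p 0 / L) - Real.cos κ := by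
      simp only [hAdef, hcθ, mul_zero, zero_div, add_zero]
    rw [← sub_eq_zero, ← this]; exact hA

end Loop

end Summit.HubbardSuperconductivity.HubbardSuperconductivity.Theorems.NodalDiracTwist
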